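import Mathlib
import Literature.NumberTheory.Transcendental.KZHyperbolicLadder
import Literature.NumberTheory.Transcendental.KZCalculusProofs
import Literature.NumberTheory.Transcendental.KZIdealTetrahedron
import Summits.KontsevichZagierPeriods.KontsevichZagierPeriods.Theorems.HyperbolicBlochOffTetraSectorKernelTetraSubsetRungTwo

/-!
# `OffTetraSectorKernel` (stmt-KontsevichZagierPeriods-10557), line `odd-hyperbolic-ladder`:
# the ladder remainder needs no separate tetrahedral term

Stub `offLadderKernel_iff`. "Conjecture 1 off the hyperbolic scissors ladder" — every formal
combination `c` of Kontsevich–Zagier integral representations with `eval c = 0` lies in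
`KZ.relations ⊔ closure (KZ.ladderRelators)` — is EQUIVALENT to its form with the crux's
tetrahedral value-relators (over the pinned ideal tetrahedra `T z = idealTetrahedron z`) adjoined
as a third summand: the tetrahedral value-relators already lie in
`KZ.relations ⊔ closure (KZ.rungRelators 2)` (`tetraRelators_subset_relations_sup_rungTwo`: the
ideal tetrahedra are rung-`2` polytopes and admissible representations with the same domain and
integrand are exchangeable modulo the moves), and rung `2` is part of the ladder
(`KZ.ladderRelators = ⋃ n, KZ.rungRelators n`); the rest is bookkeeping in the subgroup lattice
of `KZ.FormalRep`.

References: M. Kontsevich, D. Zagier, *Periods* (2001), §1.2; A. B. Goncharov, *Volumes of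
hyperbolic manifolds and mixed Tate motives* (1999), §1.7.
-/

noncomputable section

open Set MeasureTheory
open Literature.NumberTheory.Transcendental

namespace Summit.KontsevichZagierPeriods.HyperbolicBloch.OffTetraSectorKernel

/-- Rung `2` is part of the ladder: `KZ.relations ⊔ closure (KZ.rungRelators 2) ≤
KZ.relations ⊔ closure KZ.ladderRelators` (`KZ.ladderRelators = ⋃ n, KZ.rungRelators n`).
[folklore] -/
theorem tetraRung_relations_sup_rungTwo_le_ladder :
    KZ.relations ⊔ AddSubgroup.closure (KZ.rungRelators 2) ≤
      KZ.relations ⊔ AddSubgroup.closure KZ.ladderRelators :=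
  sup_le_sup_left (AddSubgroup.closure_mono (subset_iUnion KZ.rungRelators 2)) KZ.relations

/-- **The ladder remainder absorbs the tetrahedral oracle.** Conjecture 1 off the hyperbolic
scissors ladder with the tetrahedral value-relators of the pinned ideal tetrahedra adjoined is
equivalent to Conjecture 1 off the ladder alone: the tetrahedral value-relators are rung-`2`
value-relators modulo the moves (`tetraRelators_subset_relations_sup_rungTwo`), rung `2` is part
of the ladder, and the converse is monotonicity of `⊔`. [cite: Goncharov1999, §1.7] -/
theorem offLadderKernel_iff : (∀ (T : ℂ → Set (Fin 3 → ℝ)), (∀ z, T z = {p | 0 < p 1 ∧ z.re * p 1 < z.im * p 0 ∧ z.im * (p 0 - 1) < (z.re - 1) * p 1 ∧ 0 < p 2 ∧ 0 < z.im * (p 0 ^ 2 + p 1 ^ 2 + p 2 ^ 2 - p 0) + (z.re - Complex.normSq z) * p 1}) → ∀ c : Literature.NumberTheory.Transcendental.KZ.FormalRep, Literature.NumberTheory.Transcendental.KZ.eval c = 0 → c ∈ Literature.NumberTheory.Transcendental.KZ.relations ⊔ AddSubgroup.closure {d : Literature.NumberTheory.Transcendental.KZ.FormalRep | ∃ ρ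 : ℂ → Literature.NumberTheory.Transcendental.KZ.IntegralRep 3, (∀ z, IsAlgebraic ℚ z → 0 < z.im → (ρ z).domain = T z ∧ Set.EqOn (ρ z).integrand (fun p => 1 / p 2 ^ 3) (T z)) ∧ ∃ (k : ℕ) (z : Fin k → ℂ) (n : Fin k → ℤ), (∀ i, IsAlgebraic ℚ (z i)) ∧ (∀ i, 0 < (z i).im) ∧ ∑ i, (n i : ℝ) * (ρ (z i)).value = 0 ∧ d = ∑ i, n i • Literature.NumberTheory.Transcendental.KZ.of (ρ (z i))} ⊔ AddSubgroup.closure Literature.NumberTheory.Transcendental.KZ.ladderRelators) ↔ (∀ c : Literature.NumberTheory.Transcendental.KZ.FormalRep, Literature.NumberTheory.Transcendental.KZ.eval c = 0 → c ∈ Literature.NumberTheory.Transcendental.KZ.relations ⊔ AddSubgroup.closure Literature.NumberTheory.Transcendental.KZ.ladderRelators) := by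
  constructor
  · -- instantiate at the pinned family and absorb the tetrahedral closure into the ladder
    intro h c hc
    refine sup_le (sup_le le_sup_left ((AddSubgroup.closure_le _).mpr fun d hd => ?_)) le_sup_right
      (h idealTetrahedron (fun _ => rfl) c hc)
    exact tetraRung_relations_sup_rungTwo_le_ladder
      (tetraRelators_subset_relations_sup_rungTwo idealTetrahedron (fun _ => rfl) d hd)
  · -- monotonicity: `relations ⊔ closure ladder ≤ relations ⊔ closure tetra ⊔ closure ladder`
    intro h T _ c hc
    refine (?_ : KZ.relations ⊔ AddSubgroup.closure KZ.ladderRelators ≤ _) (h c hc)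
    exact sup_le_sup_right le_sup_left _

end Summit.KontsevichZagierPeriods.HyperbolicBloch.OffTetraSectorKernel

end
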